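import Summits.BirchSwinnertonDyer.Rank1Residual.Additive.LocalModelTransportH1
import Literature.NumberTheory.EllipticCurves.LocalKummerMap
import HarnessLib

/-!
# Model transport in local Galois cohomology, II: points and Kummer classes along `E' → E`
# (cell `b2b-bsdres`, CLASS-CLOSURE lane, class O10 — x1b GEN 41, class lead; file 102 of the series)

HONEST FRAMING (cell `b2b-bsdres`, run/shared/lean/b2b/bsd-rank1-residual/, verbatim in every
file): the goal of the cell is to DELETE the COMBINATION-SHAPED residual classes of the
Birch–Swinnerton-Dyer formula for ALL analytic-rank `≤ 1` elliptic curves over `ℚ` — "full BSD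
formula for every rank `≤ 1` curve in class `C`" assembled STRICTLY from published theorems — so
that the rank-`≤ 1` remainder becomes exactly the CONSTRUCTION-SHAPED classes, which are TYPED
(missing-input `Prop`s), NOT attempted. This is not "finishing BSD". CLASS-CLOSURE lane: prove
what is provable now; shrink each hard class to its core with data; no claim beyond stated classes;
research routes on CONSTRUCTION-SHAPED X12 / O10; census / instrument output = EVIDENCE / conjecture
items, NEVER a Literature fact; `RESIDUAL-MAP.md` marks change only by signed lines. THIS FILE:
TOOL THEOREMS ONLY — no definition, no named Literature fact, no `sorry`, axioms standard; nothing
is booked; no label / mark / count / sub-cell moves; (C1_η), (C2_η-GZ), (C3_η) stay typed as filed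
(cc-typer-6's pen); nothing about `BSD(W, p)` of any pair is claimed.

## What (file 101 continued; `W/K` a Weierstrass curve, `E' → E` a `K`-algebra map, `τ` the
## comparison element `ι_E ∘ τ = j ∘ ι_{E'}`, `J = Point.map j : W(Ē') → W(Ē)`)

* §1 `pointsMap_smul_eq_map_pointsMap` — **`ι_E(τ • P) = J(ι_{E'} P)`** on `W(K̄)`;
  `map_smul_localPoints` — **`J(r σ • Q) = σ • J Q`** on `W(Ē')` (`r : Γ_E → Γ_{E'}`).
* §2 **`transport_mem_kummerLocalConditionAt`** — an additive `Θ : H¹(Γ_{E'}, E[n]) → H¹(Γ_E, E[n])`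
  with the cocycle description `Θ[ψ] = [σ ↦ τ · ψ(r σ)]` (file 101 `exists_transportH1`) maps the
  local Kummer condition `𝓛_{E'} = ker(H¹(Γ_{E'}, E[n]) → H¹(Γ_{E'}, E(Ē')))` into `𝓛_E`: if
  `ι_{E'} ∘ ψ = ∂R'` then `ι_E ∘ (τ ψ ∘ r) = ∂(J R')`; `map_le_kummerLocalConditionAt` (subgroup form).

Application (file 103): with `E' = ℚ_{v₀}`, `E = ℚ_[p]`, `Θ` bijective, `Θ(𝓚_{v₀}) = 𝓚_p` by the
equality of orders, so the minus line `Θ⁻¹(Σ_p)` is complementary to `𝓚_{v₀}` (file 100's `hCL`).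

References: [SilvermanAEC2009] VIII.§2, X.§4; [SerreGaloisCohomology1997] I §2.4, II §1.1;
[MilneFT2022] Ch. 6–7.
-/

noncomputable section

open scoped Classical

open Field CategoryTheory WeierstrassCurve

namespace Summit.BirchSwinnertonDyer.Rank1Residual.Additive.LocalModelTransport

open Literature.NumberTheory.GaloisRepresentations Literature.NumberTheory.EllipticCurves
open scoped ContRepresentation

universe u

variable {K : Type u} [Field K] (W : WeierstrassCurve K) (E' E : Type u) [Field E'] [Field E]
  [Algebra K E'] [Algebra K E] [Algebra E' E] [IsScalarTower K E' E]

/-! ## §1 Points -/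

/-- **`ι_E(τ • P) = J(ι_{E'}(P))` on `W(K̄)`** for the comparison element `τ` (`ι_E ∘ τ = j ∘ ι_{E'}`
coordinatewise), `J = Point.map j`. [cite: SilvermanAEC2009, VIII.§1] -/
theorem pointsMap_smul_eq_map_pointsMap {τ : absoluteGaloisGroup K}
    (hτ : ∀ x : AlgebraicClosure K,
      absClosureEmbedding K E (τ • x) = absClosureEmbedding E' E (absClosureEmbedding K E' x))
    (P : geomPoints W) :
    pointsMap W E (τ • P) =
      Affine.Point.map (W' := W) ((absClosureEmbedding E' E).restrictScalars K) (pointsMap W E' P) := by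
  have hcomp : (closureEmb (K := K) E).comp
      ((show AlgebraicClosure K ≃ₐ[K] AlgebraicClosure K from τ) : AlgebraicClosure K →ₐ[K] AlgebraicClosure K) =
      ((absClosureEmbedding E' E).restrictScalars K).comp (closureEmb (K := K) E') :=
    AlgHom.ext fun x => hτ x
  change Affine.Point.map (W' := W) (closureEmb (K := K) E)
      (Affine.Point.map (W' := W)
        ((show AlgebraicClosure K ≃ₐ[K] AlgebraicClosure K from τ) : AlgebraicClosure K →ₐ[K] AlgebraicClosure K) P) =
    Affine.Point.map (W' := W) ((absClosureEmbedding E' E).restrictScalars K)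
      (Affine.Point.map (W' := W) (closureEmb (K := K) E') P)
  rw [Affine.Point.map_map, Affine.Point.map_map, hcomp]

/-- **`J(r σ • Q) = σ • J(Q)` on `W(Ē')`** (the right-hand action written out as `Point.map σ`):
the map on points induced by the chosen embedding `j : Ē' → Ē` is equivariant along
`r : Γ_E → Γ_{E'}` (`j (r σ • x) = σ • j x`). [cite: SerreGaloisCohomology1997, I §2.4 (compatible pairs)] -/
theorem map_smul_localPoints (σ : absoluteGaloisGroup E) (Q : localPoints W E') :
    Affine.Point.map (W' := W) ((absClosureEmbedding E' E).restrictScalars K) (absGaloisRestrict E' E σ • Q) =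
      Affine.Point.map (W' := W)
        ((AlgEquiv.restrictScalars K (show AlgebraicClosure E ≃ₐ[E] AlgebraicClosure E from σ) :
            AlgebraicClosure E ≃ₐ[K] AlgebraicClosure E) : AlgebraicClosure E →ₐ[K] AlgebraicClosure E)
        (Affine.Point.map (W' := W) ((absClosureEmbedding E' E).restrictScalars K) Q) := by
  have hcomp : ((absClosureEmbedding E' E).restrictScalars K).comp
      ((AlgEquiv.restrictScalars K
          (show AlgebraicClosure E' ≃ₐ[E'] AlgebraicClosure E' from absGaloisRestrict E' E σ) :
          AlgebraicClosure E' ≃ₐ[K] AlgebraicClosure E') : AlgebraicClosure E' →ₐ[K] AlgebraicClosure E') =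
      (((AlgEquiv.restrictScalars K (show AlgebraicClosure E ≃ₐ[E] AlgebraicClosure E from σ) :
          AlgebraicClosure E ≃ₐ[K] AlgebraicClosure E) : AlgebraicClosure E →ₐ[K] AlgebraicClosure E)).comp
        ((absClosureEmbedding E' E).restrictScalars K) :=
    AlgHom.ext fun x => absGaloisRestrict_apply_smul E' E σ x
  rw [localPoints.smul_def]
  change Affine.Point.map (W' := W) _ (Affine.Point.map (W' := W) _ Q) =
    Affine.Point.map (W' := W) _ (Affine.Point.map (W' := W) _ Q)
  rw [Affine.Point.map_map, Affine.Point.map_map, hcomp]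

/-! ## §2 Kummer classes -/

/-- **`Θ(𝓛_{E'}) ⊆ 𝓛_E`**: an additive `Θ : H¹(Γ_{E'}, E[n]) → H¹(Γ_E, E[n])` with the cocycle
description `Θ[ψ] = [σ ↦ τ · ψ(r σ)]` (file 101) maps the local Kummer condition at `E'` into the one
at `E`: if `ι_{E'} ∘ ψ = ∂R'` on `Γ_{E'}` then `ι_E ∘ (σ ↦ τ ψ(r σ)) = ∂(J R')` on `Γ_E` (§1).
[cite: SilvermanAEC2009, X.§4 diagram (**)] [cite: SerreGaloisCohomology1997, I §2.4] -/
theorem transport_mem_kummerLocalConditionAt (n : ℤ) {τ : absoluteGaloisGroup K}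
    (hτ : ∀ x : AlgebraicClosure K,
      absClosureEmbedding K E (τ • x) = absClosureEmbedding E' E (absClosureEmbedding K E' x))
    (Θ : galoisCohomology (GaloisRep.restrictField E' (W.torsionGaloisModule n)) 1 →+
      galoisCohomology (GaloisRep.restrictField E (W.torsionGaloisModule n)) 1)
    (hΘ : ∀ ψ : contOneCocycles (DiscreteGaloisModule.toTopRep
        (GaloisRep.restrictField E' (W.torsionGaloisModule n))),
      ∃ φ : contOneCocycles (DiscreteGaloisModule.toTopRep
        (GaloisRep.restrictField E (W.torsionGaloisModule n))),
        oneCocycleClass _ φ = Θ (oneCocycleClass _ ψ) ∧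
        ∀ σ : absoluteGaloisGroup E, φ.1 σ = (W.torsionGaloisModule n) τ (ψ.1 (absGaloisRestrict E' E σ)))
    {ξ : galoisCohomology (GaloisRep.restrictField E' (W.torsionGaloisModule n)) 1}
    (hξ : ξ ∈ W.kummerLocalConditionAt n E') :
    Θ ξ ∈ W.kummerLocalConditionAt n E := by
  obtain ⟨ψ, rfl⟩ := oneCocycleClass_surjective _ ξ
  obtain ⟨φ, hφ, hφσ⟩ := hΘ ψ
  -- `ι_{E'} ∘ ψ = ∂R'`
  rw [mem_kummerLocalConditionAt_iff, galoisCohomology.map_one_oneCocycleClass] at hξ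
  obtain ⟨R', hR'⟩ := (oneCocycleClass_eq_zero_iff _ _).mp hξ
  have hR : ∀ t : absoluteGaloisGroup E',
      pointsMap W E' ((ψ.1 t : geomTorsion W n) : geomPoints W) = t • R' - R' := fun t => hR' t
  -- `ι_E ∘ φ = ∂(J R')`
  rw [← hφ, mem_kummerLocalConditionAt_iff, galoisCohomology.map_one_oneCocycleClass]
  refine (oneCocycleClass_eq_zero_iff _ _).mpr
    ⟨Affine.Point.map (W' := W) ((absClosureEmbedding E' E).restrictScalars K) R', fun σ => ?_⟩
  change pointsMap W E ((φ.1 σ : geomTorsion W n) : geomPoints W) =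
    Affine.Point.map (W' := W)
        ((AlgEquiv.restrictScalars K (show AlgebraicClosure E ≃ₐ[E] AlgebraicClosure E from σ) :
            AlgebraicClosure E ≃ₐ[K] AlgebraicClosure E) : AlgebraicClosure E →ₐ[K] AlgebraicClosure E)
        (Affine.Point.map (W' := W) ((absClosureEmbedding E' E).restrictScalars K) R') -
      Affine.Point.map (W' := W) ((absClosureEmbedding E' E).restrictScalars K) R'
  rw [hφσ σ]
  change pointsMap W E ((τ • ψ.1 (absGaloisRestrict E' E σ) : geomTorsion W n) : geomPoints W) = _
  rw [Literature.NumberTheory.EllipticCurves.AddSubgroup.torsionBy.coe_smul,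
    pointsMap_smul_eq_map_pointsMap W E' E hτ, hR, ← map_smul_localPoints W E' E σ R']
  exact map_sub (Affine.Point.map (W' := W) ((absClosureEmbedding E' E).restrictScalars K)) _ _

/-- Subgroup form: **`Θ(𝓛_{E'}) ≤ 𝓛_E`**. [cite: SilvermanAEC2009, X.§4 diagram (**)] -/
theorem map_kummerLocalConditionAt_le (n : ℤ) {τ : absoluteGaloisGroup K}
    (hτ : ∀ x : AlgebraicClosure K,
      absClosureEmbedding K E (τ • x) = absClosureEmbedding E' E (absClosureEmbedding K E' x))
    (Θ : galoisCohomology (GaloisRep.restrictField E' (W.torsionGaloisModule n)) 1 →+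
      galoisCohomology (GaloisRep.restrictField E (W.torsionGaloisModule n)) 1)
    (hΘ : ∀ ψ : contOneCocycles (DiscreteGaloisModule.toTopRep
        (GaloisRep.restrictField E' (W.torsionGaloisModule n))),
      ∃ φ : contOneCocycles (DiscreteGaloisModule.toTopRep
        (GaloisRep.restrictField E (W.torsionGaloisModule n))),
        oneCocycleClass _ φ = Θ (oneCocycleClass _ ψ) ∧
        ∀ σ : absoluteGaloisGroup E, φ.1 σ = (W.torsionGaloisModule n) τ (ψ.1 (absGaloisRestrict E' E σ))) :
    (W.kummerLocalConditionAt n E').map Θ ≤ W.kummerLocalConditionAt n E := by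
  rintro _ ⟨ξ, hξ, rfl⟩
  exact transport_mem_kummerLocalConditionAt W E' E n hτ Θ hΘ hξ

/-- **`Θ(𝓛_{E'}) = 𝓛_E` when `Θ` is injective and the two Kummer groups are finite of the same
order** (the case `E' ≅ E`: both are `E(E)/n ≅ E(E')/n`). [cite: SilvermanAEC2009, X.§4 diagram (**)] -/
theorem map_kummerLocalConditionAt_eq (n : ℤ) {τ : absoluteGaloisGroup K}
    (hτ : ∀ x : AlgebraicClosure K,
      absClosureEmbedding K E (τ • x) = absClosureEmbedding E' E (absClosureEmbedding K E' x))
    (Θ : galoisCohomology (GaloisRep.restrictField E' (W.torsionGaloisModule n)) 1 →+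
      galoisCohomology (GaloisRep.restrictField E (W.torsionGaloisModule n)) 1)
    (hΘ : ∀ ψ : contOneCocycles (DiscreteGaloisModule.toTopRep
        (GaloisRep.restrictField E' (W.torsionGaloisModule n))),
      ∃ φ : contOneCocycles (DiscreteGaloisModule.toTopRep
        (GaloisRep.restrictField E (W.torsionGaloisModule n))),
        oneCocycleClass _ φ = Θ (oneCocycleClass _ ψ) ∧
        ∀ σ : absoluteGaloisGroup E, φ.1 σ = (W.torsionGaloisModule n) τ (ψ.1 (absGaloisRestrict E' E σ)))
    (hinj : Function.Injective Θ) [Finite (W.kummerLocalConditionAt n E)]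
    (hcard : Nat.card (W.kummerLocalConditionAt n E') = Nat.card (W.kummerLocalConditionAt n E)) :
    (W.kummerLocalConditionAt n E').map Θ = W.kummerLocalConditionAt n E := by
  refine AddSubgroup.eq_of_le_of_card_ge (map_kummerLocalConditionAt_le W E' E n hτ Θ hΘ) ?_
  rw [← hcard]
  exact le_of_eq (AddSubgroup.card_map_of_injective hinj).symm

end Summit.BirchSwinnertonDyer.Rank1Residual.Additive.LocalModelTransport

end
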